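import Literature.AlgebraicGeometry.Deformation.DefectCochain
import Literature.AlgebraicGeometry.Modules.FrameRestriction
import Literature.AlgebraicGeometry.Modules.CechEndCochainFamily
import HarnessLib

/-!
# Restricting frame covers and lifted transition matrices to smaller opens

Setting of `Deformation/DefectCochain.lean`: `j : Y ⟶ Z₀`, `i : Z₀ ⟶ Z₁`,
`eI : i_* j_* 𝒪_Y ≅ 𝓘 = Ker(i♯)`, an `𝒪_{Z₀}`-module `F` with a frame cover `C = (U_a, I_a, e_a)` over
opens `U_a ⊆ Z₁`, lifts `L = (T̃_{ab})`, `E = j^*F` with its base framing `C.baseFraming j` on the opens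
`U^Y_a = j⁻¹i⁻¹U_a` and the defect `2`-cochain `κ(c)`.

Given smaller opens `W_a ≤ U_a` (SAME index set):

* `FrameCover.restrict C W hW` — the frame cover over the `W_a` with the restricted frames
  `e_a|_{i⁻¹W_a}`; its transition matrices are those of `C` (`trans_restrict`);
* `Lifts.restrict` — the restricted lifts `T̃_{ab}|_{W_a ∩ W_b}`; `TOn`, `defect` and `κ(defect)` are
  unchanged (`TOn_restrict`, `defect_restrict`, `kdefAt_restrict`);
* `baseFraming_restrict_e` / `T_baseFraming_restrict` / `op_baseFraming_restrict` — the base framing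
  of the restricted cover consists of the restricted pulled-back frames, with the same transition
  matrices and the same local matrix endomorphisms;
* `toLocalFamily_defectCochain_restrict` — **the family of local endomorphisms of the defect cochain
  of the restricted data is the restriction (`Cech.restrictFamily`) of that of the original data**;
* `shrinkOpen U V = U ∖ ij(Y ∖ V)` — for `j`, `i` closed immersions and opens `V_a ⊆ U^Y_a` of `Y`
  covering `Y`, the opens `W_a = shrinkOpen (U_a) (V_a) ≤ U_a` of `Z₁` satisfy `j⁻¹i⁻¹W_a ≤ V_a`
  and still cover `Z₁` (`exists_mem_shrinkOpen`): **a refinement of the cover of `Y` is dominated by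
  a refinement of the cover of `Z₁` with the same index set.**

This is the bookkeeping behind "passing to a refinement of the cover" in the proof of
Hartshorne, *Deformation Theory*, Thm. 7.1. Everything is proved; no named facts.

## References

* R. Hartshorne, *Deformation Theory*, GTM 257 (2010), §7, proof of Thm. 7.1. [Hartshorne2010]
* R. Hartshorne, *Algebraic Geometry*, GTM 52 (1977), III Lemma 4.4 (refinements). [Hartshorne1977]
-/

noncomputable section

open CategoryTheory AlgebraicGeometry Opposite TopologicalSpace Limits

namespace Literature.AlgebraicGeometry.Deformation

open Literature.AlgebraicGeometry.Modules Literature.AlgebraicGeometry.Motives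

universe u

variable {Y Z₀ Z₁ : Scheme.{u}} {j : Y ⟶ Z₀} {i : Z₀ ⟶ Z₁} {F : Z₀.Modules} {ι : Type u}

/-- `j⁻¹i⁻¹` is monotone. [folklore] -/
lemma baseOpen_mono (j : Y ⟶ Z₀) (i : Z₀ ⟶ Z₁) {W W' : Z₁.Opens} (h : W' ≤ W) :
    baseOpen j i W' ≤ baseOpen j i W :=
  ((Opens.map j.base).map ((Opens.map i.base).map (homOfLE h))).le

namespace FrameCover

variable (C : FrameCover i F ι) (W : ι → Z₁.Opens) (hW : ∀ a, W a ≤ C.U a)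

/-! ### Restricting a frame cover -/

/-- **The frame cover over smaller opens `W_a ≤ U_a`**, with the restricted frames `e_a|_{i⁻¹W_a}`.
[cite: Hartshorne2010, §7 (proof of Thm. 7.1)] -/
@[reducible] def restrict : FrameCover i F ι where
  U := W
  I := C.I
  e a := SheafOfModules.restrictTrivialisation (R := Z₀.ringCatSheaf) (C.incl (hW a)) (C.e a)

/-- The transition matrices of the restricted frame cover are those of `C`. [folklore] -/
theorem trans_restrict (a b : ι) (V : Z₁.Opens) (ha : V ≤ W a) (hb : V ≤ W b) :
    (C.restrict W hW).trans a b V ha hb = C.trans a b V (ha.trans (hW a)) (hb.trans (hW b)) := by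
  change transition (SheafOfModules.restrictTrivialisation (R := Z₀.ringCatSheaf) (C.incl (hW a)) (C.e a))
    (SheafOfModules.restrictTrivialisation (R := Z₀.ringCatSheaf) (C.incl (hW b)) (C.e b)) _ _ =
    transition (C.e a) (C.e b) _ _
  rw [transition_restrictTrivialisation]
  exact congrArg₂ (transition (C.e a) (C.e b)) (Subsingleton.elim _ _) (Subsingleton.elim _ _)

namespace Lifts

variable {C} (L : C.Lifts)

/-- **The restricted lifts `T̃_{ab}|_{W_a ∩ W_b}`.** [cite: Hartshorne2010, §7 (proof of Thm. 7.1)] -/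
@[reducible] def restrict : (C.restrict W hW).Lifts where
  T a b := L.TOn a b (W a ⊓ W b) (inf_le_left.trans (hW a)) (inf_le_right.trans (hW b))
  map_T a b := by rw [L.map_TOn, trans_restrict]

/-- `TOn` of the restricted lifts is `TOn` of `L`. [folklore] -/
theorem TOn_restrict (a b : ι) (V : Z₁.Opens) (ha : V ≤ W a) (hb : V ≤ W b) :
    (L.restrict W hW).TOn a b V ha hb = L.TOn a b V (ha.trans (hW a)) (hb.trans (hW b)) :=
  L.TOn_map a b (inf_le_left.trans (hW a)) (inf_le_right.trans (hW b)) (le_inf ha hb)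

/-- The defect of the restricted lifts is the defect of `L`. [folklore] -/
theorem defect_restrict (a b d : ι) (V : Z₁.Opens) (ha : V ≤ W a) (hb : V ≤ W b) (hd : V ≤ W d) :
    (L.restrict W hW).defect a b d V ha hb hd =
      L.defect a b d V (ha.trans (hW a)) (hb.trans (hW b)) (hd.trans (hW d)) := by
  rw [defect, defect, TOn_restrict, TOn_restrict, TOn_restrict]

variable (eI : (Scheme.Modules.pushforward i).obj ((Scheme.Modules.pushforward j).obj (unitModule Y)) ≅
    idealModule i)

/-- `κ(defect)` of the restricted lifts is that of `L`. [folklore] -/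
theorem kdefAt_restrict (a b d : ι) (V : Z₁.Opens) (ha : V ≤ W a) (hb : V ≤ W b) (hd : V ≤ W d) :
    (L.restrict W hW).kdefAt eI a b d V ha hb hd =
      L.kdefAt eI a b d V (ha.trans (hW a)) (hb.trans (hW b)) (hd.trans (hW d)) :=
  matrixOfIdeal_congr eI V (L.defect_restrict W hW a b d V ha hb hd) _ _

end Lifts

/-! ### The base framing of the restricted cover -/

variable (j)

/-- **The frames of the base framing of the restricted cover are the restricted pulled-back frames**
(`f^*(e|_V) = (f^*e)|_{f⁻¹V}`). [folklore] -/
theorem baseFraming_restrict_e (a : ι) :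
    ((C.restrict W hW).baseFraming j).e a =
      SheafOfModules.restrictTrivialisation (R := Y.ringCatSheaf) ((Opens.map j.base).map (C.incl (hW a)))
        ((C.baseFraming j).e a) :=
  pullbackFrame_restrictTrivialisation j (C.incl (hW a)) (C.e a)

/-- The transition matrices of the base framing of the restricted cover are those of the base framing.
[folklore] -/
theorem T_baseFraming_restrict (a b : ι) (V : Y.Opens) (ha : V ≤ baseOpen j i (W a))
    (hb : V ≤ baseOpen j i (W b)) :
    ((C.restrict W hW).baseFraming j).T a b V ha hb =
      (C.baseFraming j).T a b V (ha.trans (baseOpen_mono j i (hW a))) (hb.trans (baseOpen_mono j i (hW b))) := by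
  rw [Framing.T, Framing.T, baseFraming_restrict_e, baseFraming_restrict_e, transition_restrictTrivialisation]
  exact congrArg₂ (transition ((C.baseFraming j).e a) ((C.baseFraming j).e b)) (Subsingleton.elim _ _)
    (Subsingleton.elim _ _)

/-- **The local matrix endomorphisms of the two base framings agree.** [folklore] -/
theorem op_baseFraming_restrict (a z : ι) (V : Y.Opens) (ha : V ≤ baseOpen j i (W a))
    (hz : V ≤ baseOpen j i (W z)) (A : Matrix (C.I a) (C.I z) Γ(Y, V)) :
    ((C.restrict W hW).baseFraming j).op a z V ha hz A =
      (C.baseFraming j).op a z V (ha.trans (baseOpen_mono j i (hW a))) (hz.trans (baseOpen_mono j i (hW z))) A := by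
  rw [Framing.op, Framing.op, T_baseFraming_restrict, baseFraming_restrict_e, matrixEnd_restrictTrivialisation]
  exact congrArg (fun k => matrixEnd ((C.baseFraming j).e a) k _) (Subsingleton.elim _ _)

variable {j}

/-! ### The defect cochain of the restricted data -/

namespace Lifts

variable {C} (L : C.Lifts)
  (eI : (Scheme.Modules.pushforward i).obj ((Scheme.Modules.pushforward j).obj (unitModule Y)) ≅
    idealModule i)

include hW in
/-- `W_a ∩ W_b ∩ W_d ≤ U_a ∩ U_b ∩ U_d`. [folklore] -/
lemma inf₃_le_inf₃ (a b d : ι) : W a ⊓ W b ⊓ W d ≤ C.U a ⊓ C.U b ⊓ C.U d :=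
  inf_le_inf (inf_le_inf (hW a) (hW b)) (hW d)

/-- **The matrices of the defect cochain of the restricted data are those of the defect cochain.**
[folklore] -/
theorem defectCochain_restrict_mat (α : Fin 3 → ι) (V : Y.Opens)
    (hV : ∀ k, V ≤ ((C.restrict W hW).baseFraming j).U (α k)) :
    ((L.restrict W hW).defectCochain eI).mat α V hV =
      (L.defectCochain eI).mat α V (fun k => (hV k).trans (baseOpen_mono j i (hW (α k)))) := by
  rw [defectCochain_mat, defectCochain_mat, kdefAt_restrict,
    ← L.kdefAt_map eI (α 0) (α 1) (α (Fin.last 2)) (inf_le_left.trans inf_le_left) (inf_le_left.trans inf_le_right)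
      inf_le_right (inf₃_le_inf₃ W hW (α 0) (α 1) (α (Fin.last 2))), Matrix.map_map]
  congr 1
  funext x
  exact secRes_secRes _ _ _

/-- `U^Y`-refinement inequality: `j⁻¹i⁻¹W_a ≤ j⁻¹i⁻¹U_a`. [folklore] -/
lemma baseOpen_restrict_le (a : ι) : ((C.restrict W hW).baseFraming j).U a ≤ (C.baseFraming j).U a :=
  baseOpen_mono j i (hW a)

/-- **The family of local endomorphisms of the defect cochain of the restricted data is the restriction
of that of the original data.** [cite: Hartshorne2010, §7 (proof of Thm. 7.1)] -/
theorem toLocalFamily_defectCochain_restrict :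
    ((C.restrict W hW).baseFraming j).toLocalFamily ((L.restrict W hW).defectCochain eI) =
      Cech.restrictFamily (baseOpen_restrict_le W hW) ((C.baseFraming j).toLocalFamily (L.defectCochain eI)) := by
  funext α
  rw [Framing.toLocalFamily_apply, Cech.restrictFamily, Framing.restrictHom_toLocalFamily,
    defectCochain_restrict_mat, op_baseFraming_restrict]

end Lifts

end FrameCover

/-! ### Dominating a refinement on `Y` by a refinement on `Z₁` -/

section Shrink

variable (j i) [IsClosedImmersion j] [IsClosedImmersion i]

/-- `y ↦ i(j(y))` is a closed map. [cite: StacksProject, Tag 01QN] -/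
lemma isClosedMap_comp_base : IsClosedMap (fun y : Y => i.base (j.base y)) :=
  i.isClosedEmbedding.isClosedMap.comp j.isClosedEmbedding.isClosedMap

/-- `y ↦ i(j(y))` is injective. [cite: StacksProject, Tag 01QN] -/
lemma injective_comp_base : Function.Injective (fun y : Y => i.base (j.base y)) :=
  i.isClosedEmbedding.injective.comp j.isClosedEmbedding.injective

/-- **The open `U ∖ ij(Y ∖ V)` of `Z₁`.** [folklore] -/
def shrinkOpen (U : Z₁.Opens) (V : Y.Opens) : Z₁.Opens :=
  U ⊓ ⟨((fun y : Y => i.base (j.base y)) '' (V : Set Y)ᶜ)ᶜ,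
    (isClosedMap_comp_base j i _ V.isOpen.isClosed_compl).isOpen_compl⟩

/-- `U ∖ ij(Y ∖ V) ≤ U`. [folklore] -/
lemma shrinkOpen_le (U : Z₁.Opens) (V : Y.Opens) : shrinkOpen j i U V ≤ U := inf_le_left

/-- **`j⁻¹i⁻¹(U ∖ ij(Y ∖ V)) ≤ V`.** [folklore] -/
lemma baseOpen_shrinkOpen_le (U : Z₁.Opens) (V : Y.Opens) : baseOpen j i (shrinkOpen j i U V) ≤ V := by
  intro y hy
  by_contra hyV
  exact hy.2 ⟨y, hyV, rfl⟩

/-- A point of `U` all of whose preimages lie in `V` lies in `U ∖ ij(Y ∖ V)`. [folklore] -/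
lemma mem_shrinkOpen {U : Z₁.Opens} {V : Y.Opens} {z : Z₁} (hz : z ∈ U)
    (h : ∀ y : Y, i.base (j.base y) = z → y ∈ V) : z ∈ shrinkOpen j i U V := by
  refine ⟨hz, ?_⟩
  rintro ⟨y, hyV, rfl⟩
  exact hyV (h y rfl)

/-- **A refinement `V_a ⊆ j⁻¹i⁻¹U_a` covering `Y` is dominated by the refinement
`W_a = U_a ∖ ij(Y ∖ V_a)` of `(U_a)`, which still covers `Z₁`.** [cite: Hartshorne1977, III Lemma 4.4] -/
theorem exists_mem_shrinkOpen {U : ι → Z₁.Opens} {V : ι → Y.Opens} (hVU : ∀ a, V a ≤ baseOpen j i (U a))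
    (hU : ∀ z : Z₁, ∃ a, z ∈ U a) (hV : iSup V = ⊤) (z : Z₁) : ∃ a, z ∈ shrinkOpen j i (U a) (V a) := by
  by_cases hz : ∃ y : Y, i.base (j.base y) = z
  · obtain ⟨y, rfl⟩ := hz
    have hy : y ∈ iSup V := by rw [hV]; trivial
    obtain ⟨a, ha⟩ := Opens.mem_iSup.mp hy
    refine ⟨a, mem_shrinkOpen j i (hVU a ha) fun y' hy' => ?_⟩
    rwa [injective_comp_base j i hy']
  · obtain ⟨a, ha⟩ := hU z
    exact ⟨a, mem_shrinkOpen j i ha fun y hy => (hz ⟨y, hy⟩).elim⟩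

end Shrink

end Literature.AlgebraicGeometry.Deformation

end
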